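import Summits.CriticalPhenomena.Ising3DConformalLimit.Theorems.FKParityRobustnessIndependentStrandsJoinStubCrossPairTreeFactorisation
import Summits.CriticalPhenomena.Ising3DConformalLimit.Theorems.FKParityRobustnessIndependentStrandsJoinStubCrossPairTreeBound
import HarnessLib

/-!
# Crux `IndependentStrandsJoin` (stmt-CriticalPhenomena-14625), line `cross-fattening-decoupling` —
# stub `stub_crossPairTree` reduced to PAIR HOLE FILLING (step (ii) isolated)

Route `FKParityRobustness`, sub-problem `Ising3DConformalLimit`; `--supports` file of the registered stub
`stub_crossPairTree`.  With step (i) (`crossMomentSq_eq_clusterSum`,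
`…StubCrossPairTreeFactorisation.lean`) and step (iii) (`stub_crossPairTreeBound` = ADC2021 Prop. A.3 in
loop-O(1) form, `…StubCrossPairTreeBound.lean`) landed, the registered stub

  `stub_crossPairTree : ∃ C > 0, ∀ l ≥ 1, ∃ N₀, ∀ N ≥ N₀, ∀ a = l·tetra ⊂ Λ_N,
     (Z^∅)⁴ · crossMomentSq G t a₀ a₁ a₂ a₃ B_l ≤ C · bubbleSum G t a B_l`     (`G = Λ_N ⊂ ℤ³`, `t = tanh β_c`)

follows from the single d = 3 statement PAIR HOLE FILLING (the twin of `stub_holeCost` for pairs of window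
points, summed over the window pairs `(v, w) ∈ B_l × B_l`):

  `(Z^∅)² · Σ_{v,w ∈ B_l} Σ_{K₁ ∈ 𝒦(a₀;a₀a₁)} Σ_{K₂ ∈ 𝒦(a₂;a₂a₃)} t^{|K₁|+|K₂|} A(a₀;K₁|K₂;v,w) · A(a₂;K₂|K₁;v,w)
      ≤ C · Σ_{v,w ∈ B_l} S(a₀a₁;v,w) · S(a₂a₃;v,w)`,
  `A(x;K|K';v,w) = Σ_{L ∈ 𝓔_∅(G − V(K'))} t^{|L|} 1[x ↝_{K∪L} v ∧ x ↝_{K∪L} w]`   (DEPLETED soup),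
  `S(xy;v,w)     = Σ_{F ∈ 𝒯(xy)} Σ_{L ∈ 𝓔_∅(G)} t^{|F|+|L|} 1[x ↝_{F∪L} v ∧ x ↝_{F∪L} w]`   (FULL soup),

i.e., summed over `v, w ∈ B_l`, `E[ P[v,w ∈ X₁ | K] · P[v,w ∈ X₂ | K] ] ≤ C · P⊗[v,w ∈ C(a₀; F₁ ∪ L'₁)] ·
P⊗[v,w ∈ C(a₂; F₂ ∪ L'₂)]` with
independent full soups `L'ᵢ ~ ℓ^∅_G`: replacing the soup domains `G − V(K₂)`, `G − V(K₁)` by `G` (filling the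
holes left by the other strand's cluster) costs at most a constant — the only step of the stub that is not in
print (no monotonicity of loop-O(1) connectivities in the domain).  `crossMomentSq_le_bubbleSum_of_pairHoleFilling`
is the graph-level implication (every finite graph, `β ≥ 0`, `a₀ ≠ a₁`, `a₂ ≠ a₃`, any window `B`, any
`C ≥ 0`); `crossPairTree_of_pairHoleFilling` is the box-level implication whose conclusion is the registered
signature of `stub_crossPairTree` verbatim, and `stub_crossPairTreeReduction` its registered `let`-free spelling.
Chain: `(Z^∅)⁴ E = (Z^∅)² [(Z^∅)² Σ_{v,w} Σ_{K₁,K₂} t A₁A₂] ≤ (Z^∅)² C Σ_{v,w} S₁S₂ = C Σ_{v,w} (Z^∅S₁)(Z^∅S₂)`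
`≤ C Σ_{v,w} treePair₁ treePair₂ = C · bubbleSum`.

Theorem-only file.  References: M. Aizenman, H. Duminil-Copin, Ann. of Math. 194 (2021), arXiv:1912.07973,
Lemma 4.4, Prop. A.3 [AizenmanDuminilCopinAnnals2021].
-/

noncomputable section

open Finset SimpleGraph
open Literature.Probability.LatticeModels
open Summit.CriticalPhenomena.Ising3DConformalLimit.Cruxes.ParityRobustMerging.PlaquetteXorSurgery
  (tetra tetra_injective)

namespace Summit.CriticalPhenomena.Ising3DConformalLimit.Theorems

namespace StubCrossPairTree

open Summit.CriticalPhenomena.Ising3DConformalLimit.Cruxes.IndependentStrandsJoin.CrossFatteningDecoupling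
open scoped Classical BigOperators

/-- Fubini for the cluster double sum against the window double sum:
`Σ_{K₁} Σ_{K₂} c · Σ_v Σ_w f = Σ_v Σ_w Σ_{K₁} Σ_{K₂} c · f`. -/
theorem pairTree_sum_mul_sum₂ {α β γ : Type*} (s₁ : Finset α) (s₂ : Finset β) (B : Finset γ)
    (c : α → β → ℝ) (f : α → β → γ → γ → ℝ) :
    ∑ K₁ ∈ s₁, ∑ K₂ ∈ s₂, c K₁ K₂ * ∑ v ∈ B, ∑ w ∈ B, f K₁ K₂ v w =
      ∑ v ∈ B, ∑ w ∈ B, ∑ K₁ ∈ s₁, ∑ K₂ ∈ s₂, c K₁ K₂ * f K₁ K₂ v w := by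
  simp_rw [Finset.mul_sum]
  calc ∑ K₁ ∈ s₁, ∑ K₂ ∈ s₂, ∑ v ∈ B, ∑ w ∈ B, c K₁ K₂ * f K₁ K₂ v w
      = ∑ K₁ ∈ s₁, ∑ v ∈ B, ∑ K₂ ∈ s₂, ∑ w ∈ B, c K₁ K₂ * f K₁ K₂ v w :=
        Finset.sum_congr rfl fun _ _ => Finset.sum_comm
    _ = ∑ v ∈ B, ∑ K₁ ∈ s₁, ∑ K₂ ∈ s₂, ∑ w ∈ B, c K₁ K₂ * f K₁ K₂ v w := Finset.sum_comm
    _ = ∑ v ∈ B, ∑ K₁ ∈ s₁, ∑ w ∈ B, ∑ K₂ ∈ s₂, c K₁ K₂ * f K₁ K₂ v w :=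
        Finset.sum_congr rfl fun _ _ => Finset.sum_congr rfl fun _ _ => Finset.sum_comm
    _ = ∑ v ∈ B, ∑ w ∈ B, ∑ K₁ ∈ s₁, ∑ K₂ ∈ s₂, c K₁ K₂ * f K₁ K₂ v w :=
        Finset.sum_congr rfl fun _ _ => Finset.sum_comm

/-- Termwise: `Z₀S₁ ≤ T₁`, `Z₀S₂ ≤ T₂` (all nonnegative) give `Z₀²·S₁S₂ ≤ T₁T₂`. -/
theorem pairTree_chain₂ {Z0 S₁ S₂ T₁ T₂ : ℝ} (hZ0 : 0 ≤ Z0) (hS₂ : 0 ≤ S₂) (hT₁ : 0 ≤ T₁)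
    (h2 : Z0 * S₁ ≤ T₁) (h3 : Z0 * S₂ ≤ T₂) : Z0 ^ 2 * (S₁ * S₂) ≤ T₁ * T₂ :=
  calc Z0 ^ 2 * (S₁ * S₂) = (Z0 * S₁) * (Z0 * S₂) := by ring
    _ ≤ T₁ * T₂ := mul_le_mul h2 h3 (mul_nonneg hZ0 hS₂) hT₁

/-- The real-arithmetic core: `Z₀²E ≤ C·P` (hole filling) and `Z₀²P ≤ Bu` (pair tree bound, summed) give
`Z₀⁴E ≤ C·Bu`. -/
theorem pairTree_chain₃ {Z0 E C P Bu : ℝ} (hZ0 : 0 ≤ Z0) (hC : 0 ≤ C) (h1 : Z0 ^ 2 * E ≤ C * P)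
    (h2 : Z0 ^ 2 * P ≤ Bu) : Z0 ^ 4 * E ≤ C * Bu :=
  calc Z0 ^ 4 * E = Z0 ^ 2 * (Z0 ^ 2 * E) := by ring
    _ ≤ Z0 ^ 2 * (C * P) := mul_le_mul_of_nonneg_left h1 (pow_nonneg hZ0 2)
    _ = C * (Z0 ^ 2 * P) := by ring
    _ ≤ C * Bu := mul_le_mul_of_nonneg_left h2 hC

variable {V : Type*} [Fintype V] [DecidableEq V] (G : SimpleGraph V) [DecidableRel G.Adj]

/-- `treePair ≥ 0` for `t ≥ 0`. -/
theorem pairTree_treePair_nonneg {t : ℝ} (ht : 0 ≤ t) (x y v w : V) : 0 ≤ treePair G t x y v w := by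
  unfold treePair
  have h := zPair_nonneg G ht
  exact add_nonneg (mul_nonneg (mul_nonneg (h _ _) (h _ _)) (h _ _))
    (mul_nonneg (mul_nonneg (h _ _) (h _ _)) (h _ _))

/-- The full-soup pair connection sum `S(xy;v,w)` is nonnegative for `t ≥ 0`. -/
theorem pairTree_loopPairSum_nonneg {t : ℝ} (ht : 0 ≤ t) (𝒯 𝓔 : Finset (Finset (Sym2 V))) (x v w : V) :
    0 ≤ ∑ F ∈ 𝒯, ∑ L ∈ 𝓔, (if rch (F ∪ L) x v ∧ rch (F ∪ L) x w then t ^ (#F + #L) else 0) := by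
  refine Finset.sum_nonneg fun F _ => Finset.sum_nonneg fun L _ => ?_
  split_ifs
  · exact pow_nonneg ht _
  · exact le_rfl

end StubCrossPairTree

open Summit.CriticalPhenomena.Ising3DConformalLimit.Cruxes.IndependentStrandsJoin.CrossFatteningDecoupling
open StubCrossPairTree
open scoped Classical BigOperators

/-- **The second crossed moment is bounded by the bubble, GIVEN pair hole filling** (graph level).  On every
finite graph, for `β ≥ 0`, `t = tanh β`, `a₀ ≠ a₁`, `a₂ ≠ a₃`, a window `B` and `C ≥ 0`: if the depleted pair
masses are dominated ON AVERAGE over `B × B` by the full ones,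
`(Z^∅)² Σ_{v,w ∈ B} Σ_{K₁,K₂} t^{|K₁|+|K₂|} A(a₀;K₁|K₂;v,w) A(a₂;K₂|K₁;v,w) ≤ C · Σ_{v,w ∈ B} S(a₀a₁;v,w) · S(a₂a₃;v,w)`,
then `(Z^∅)⁴ · crossMomentSq ≤ C · bubbleSum`.  Proof: pair factorisation (`crossMomentSq_eq_clusterSum`), the
hypothesis, and the pair tree bound `Z^∅ · S ≤ treePair` (`StubCrossPairTree.pairTree_loopPairSum_le_treePair`)
on both copies, termwise in `(v, w)`. -/
theorem crossMomentSq_le_bubbleSum_of_pairHoleFilling (V : Type) [Fintype V] [DecidableEq V]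
    (G : SimpleGraph V) [DecidableRel G.Adj] {β : ℝ} (hβ : 0 ≤ β) (a : Fin 4 → V)
    (h01 : a 0 ≠ a 1) (h23 : a 2 ≠ a 3) (B : Finset V) {C : ℝ} (hC : 0 ≤ C)
    (hhole :
      loopO1PartitionFunction G (Real.tanh β) ∅ ^ 2 *
        ∑ v ∈ B, ∑ w ∈ B,
          ∑ K₁ ∈ srcClusters G (a 0) {a 0, a 1}, ∑ K₂ ∈ srcClusters G (a 2) {a 2, a 3},
            Real.tanh β ^ (#K₁ + #K₂) *
            ((∑ L ∈ tJoins G (offCl K₂ (a 2)) ∅,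
                if rch (K₁ ∪ L) (a 0) v ∧ rch (K₁ ∪ L) (a 0) w then Real.tanh β ^ #L else 0) *
             (∑ L ∈ tJoins G (offCl K₁ (a 0)) ∅,
                if rch (K₂ ∪ L) (a 2) v ∧ rch (K₂ ∪ L) (a 2) w then Real.tanh β ^ #L else 0))
        ≤ C * ∑ v ∈ B, ∑ w ∈ B,
          (∑ F ∈ tJoins G Set.univ {a 0, a 1}, ∑ L ∈ tJoins G Set.univ ∅,
              if rch (F ∪ L) (a 0) v ∧ rch (F ∪ L) (a 0) w then Real.tanh β ^ (#F + #L) else 0) *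
          (∑ F ∈ tJoins G Set.univ {a 2, a 3}, ∑ L ∈ tJoins G Set.univ ∅,
              if rch (F ∪ L) (a 2) v ∧ rch (F ∪ L) (a 2) w then Real.tanh β ^ (#F + #L) else 0)) :
    loopO1PartitionFunction G (Real.tanh β) ∅ ^ 4 * crossMomentSq G (Real.tanh β) (a 0) (a 1) (a 2) (a 3) B
      ≤ C * bubbleSum G (Real.tanh β) a B := by
  have ht : 0 ≤ Real.tanh β := tanh_nonneg hβ
  have hZ0 : 0 ≤ loopO1PartitionFunction G (Real.tanh β) ∅ := loopO1PartitionFunction_nonneg G ht _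
  -- the pair tree bound on both copies, summed over the window pairs
  have hST : loopO1PartitionFunction G (Real.tanh β) ∅ ^ 2 *
      ∑ v ∈ B, ∑ w ∈ B,
        (∑ F ∈ tJoins G Set.univ {a 0, a 1}, ∑ L ∈ tJoins G Set.univ ∅,
            if rch (F ∪ L) (a 0) v ∧ rch (F ∪ L) (a 0) w then Real.tanh β ^ (#F + #L) else 0) *
        (∑ F ∈ tJoins G Set.univ {a 2, a 3}, ∑ L ∈ tJoins G Set.univ ∅,
            if rch (F ∪ L) (a 2) v ∧ rch (F ∪ L) (a 2) w then Real.tanh β ^ (#F + #L) else 0)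
      ≤ bubbleSum G (Real.tanh β) a B := by
    unfold bubbleSum
    rw [Finset.mul_sum]
    refine Finset.sum_le_sum fun v _ => ?_
    rw [Finset.mul_sum]
    refine Finset.sum_le_sum fun w _ => ?_
    exact pairTree_chain₂ hZ0 (pairTree_loopPairSum_nonneg ht _ _ _ _ _) (pairTree_treePair_nonneg G ht _ _ _ _)
      (pairTree_loopPairSum_le_treePair G hβ h01 v w) (pairTree_loopPairSum_le_treePair G hβ h23 v w)
  rw [crossMomentSq_eq_clusterSum, pairTree_sum_mul_sum₂]
  exact pairTree_chain₃ hZ0 hC hhole hST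

/-- **`stub_crossPairTree` follows from PAIR HOLE FILLING (box level).**  If pair hole filling holds in the
boxes `Λ_N ⊂ ℤ³` at `β_c` with an `l`-uniform constant (hypothesis `hHF`, the shape of the line's stubs), then
the registered stub `stub_crossPairTree` holds — the conclusion is its registered signature verbatim
(`…CrossFatteningDecoupling.CrossPairTree`).  From `crossMomentSq_le_bubbleSum_of_pairHoleFilling` with
`β = β_c(3) ≥ 0` and `a` injective (`tetra_injective`). -/
theorem crossPairTree_of_pairHoleFilling
    (hHF : ∃ C : ℝ, 0 < C ∧ ∀ l : ℕ, 1 ≤ l → ∃ N₀ : ℕ, ∀ N : ℕ, N₀ ≤ N → ∀ a : Fin 4 → ↥(box 3 N),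
      (∀ i, ((a i : Site 3)) = (l : ℤ) • tetra i) →
      (let G := ((zdGraph 3).comap (Subtype.val : ↥(box 3 N) → Site 3));
       let t : ℝ := Real.tanh (criticalBeta 3);
       loopO1PartitionFunction G t ∅ ^ 2 *
           ∑ v ∈ window N l, ∑ w ∈ window N l,
             ∑ K₁ ∈ srcClusters G (a 0) {a 0, a 1}, ∑ K₂ ∈ srcClusters G (a 2) {a 2, a 3},
               t ^ (#K₁ + #K₂) *
               ((∑ L ∈ tJoins G (offCl K₂ (a 2)) ∅,
                   if rch (K₁ ∪ L) (a 0) v ∧ rch (K₁ ∪ L) (a 0) w then t ^ #L else 0) *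
                (∑ L ∈ tJoins G (offCl K₁ (a 0)) ∅,
                   if rch (K₂ ∪ L) (a 2) v ∧ rch (K₂ ∪ L) (a 2) w then t ^ #L else 0))
         ≤ C * ∑ v ∈ window N l, ∑ w ∈ window N l,
             (∑ F ∈ tJoins G Set.univ {a 0, a 1}, ∑ L ∈ tJoins G Set.univ ∅,
                 if rch (F ∪ L) (a 0) v ∧ rch (F ∪ L) (a 0) w then t ^ (#F + #L) else 0) *
             (∑ F ∈ tJoins G Set.univ {a 2, a 3}, ∑ L ∈ tJoins G Set.univ ∅,
                 if rch (F ∪ L) (a 2) v ∧ rch (F ∪ L) (a 2) w then t ^ (#F + #L) else 0))) :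
    ∃ C : ℝ, 0 < C ∧ ∀ l : ℕ, 1 ≤ l → ∃ N₀ : ℕ, ∀ N : ℕ, N₀ ≤ N → ∀ a : Fin 4 → ↥(box 3 N),
      (∀ i, ((a i : Site 3)) = (l : ℤ) • tetra i) →
      (let G := ((zdGraph 3).comap (Subtype.val : ↥(box 3 N) → Site 3));
       let t : ℝ := Real.tanh (criticalBeta 3);
       loopO1PartitionFunction G t ∅ ^ 4 * crossMomentSq G t (a 0) (a 1) (a 2) (a 3) (window N l)
         ≤ C * bubbleSum G t a (window N l)) := by
  obtain ⟨C, hC, h⟩ := hHF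
  refine ⟨C, hC, fun l hl => ?_⟩
  obtain ⟨N₀, h⟩ := h l hl
  refine ⟨N₀, fun N hN a ha => ?_⟩
  have hinj : Function.Injective a := tetra_injective hl a ha
  have h01 : a 0 ≠ a 1 := hinj.ne (by decide)
  have h23 : a 2 ≠ a 3 := hinj.ne (by decide)
  refine crossMomentSq_le_bubbleSum_of_pairHoleFilling _ _ (criticalBeta_nonneg 3) a h01 h23 (window N l)
    hC.le ?_
  -- The hypothesis, elaborated at the concrete box type, carries `Classical.propDecidable` instances in its
  -- `if`s (instance search for `Decidable (x ↝ v)` does not complete there), whereas the graph-level lemma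
  -- instantiates the constructive ones: bridge the (subsingleton) instance arguments with `convert`.
  convert h N hN a ha using 100

/-- **Registered auxiliary stub `stub_crossPairTreeReduction`** (crux stmt-CriticalPhenomena-14625, line
`cross-fattening-decoupling`; registered signature verbatim, spelled WITHOUT `let` because the stub registry cuts a
signature at its first `:=`): PAIR HOLE FILLING in the boxes implies the statement of the registered stub
`stub_crossPairTree` (its two `let`s zeta-expanded).  This is `crossPairTree_of_pairHoleFilling`. -/
theorem stub_crossPairTreeReduction :
    (∃ C : ℝ, 0 < C ∧ ∀ l : ℕ, 1 ≤ l → ∃ N₀ : ℕ, ∀ N : ℕ, N₀ ≤ N → ∀ a : Fin 4 → ↥(box 3 N),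
      (∀ i, ((a i : Site 3)) = (l : ℤ) • tetra i) →
       loopO1PartitionFunction ((zdGraph 3).comap (Subtype.val : ↥(box 3 N) → Site 3)) (Real.tanh (criticalBeta 3)) ∅ ^ 2 *
           ∑ v ∈ window N l, ∑ w ∈ window N l,
             ∑ K₁ ∈ srcClusters ((zdGraph 3).comap (Subtype.val : ↥(box 3 N) → Site 3)) (a 0) {a 0, a 1},
               ∑ K₂ ∈ srcClusters ((zdGraph 3).comap (Subtype.val : ↥(box 3 N) → Site 3)) (a 2) {a 2, a 3},
               (Real.tanh (criticalBeta 3)) ^ (#K₁ + #K₂) *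
               ((∑ L ∈ tJoins ((zdGraph 3).comap (Subtype.val : ↥(box 3 N) → Site 3)) (offCl K₂ (a 2)) ∅,
                   if rch (K₁ ∪ L) (a 0) v ∧ rch (K₁ ∪ L) (a 0) w then (Real.tanh (criticalBeta 3)) ^ #L else 0) *
                (∑ L ∈ tJoins ((zdGraph 3).comap (Subtype.val : ↥(box 3 N) → Site 3)) (offCl K₁ (a 0)) ∅,
                   if rch (K₂ ∪ L) (a 2) v ∧ rch (K₂ ∪ L) (a 2) w then (Real.tanh (criticalBeta 3)) ^ #L else 0))
         ≤ C * ∑ v ∈ window N l, ∑ w ∈ window N l,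
             (∑ F ∈ tJoins ((zdGraph 3).comap (Subtype.val : ↥(box 3 N) → Site 3)) Set.univ {a 0, a 1}, ∑ L ∈ tJoins ((zdGraph 3).comap (Subtype.val : ↥(box 3 N) → Site 3)) Set.univ ∅,
                 if rch (F ∪ L) (a 0) v ∧ rch (F ∪ L) (a 0) w then (Real.tanh (criticalBeta 3)) ^ (#F + #L) else 0) *
             (∑ F ∈ tJoins ((zdGraph 3).comap (Subtype.val : ↥(box 3 N) → Site 3)) Set.univ {a 2, a 3}, ∑ L ∈ tJoins ((zdGraph 3).comap (Subtype.val : ↥(box 3 N) → Site 3)) Set.univ ∅,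
                 if rch (F ∪ L) (a 2) v ∧ rch (F ∪ L) (a 2) w then (Real.tanh (criticalBeta 3)) ^ (#F + #L) else 0)) →
    ∃ C : ℝ, 0 < C ∧ ∀ l : ℕ, 1 ≤ l → ∃ N₀ : ℕ, ∀ N : ℕ, N₀ ≤ N → ∀ a : Fin 4 → ↥(box 3 N),
      (∀ i, ((a i : Site 3)) = (l : ℤ) • tetra i) →
       loopO1PartitionFunction ((zdGraph 3).comap (Subtype.val : ↥(box 3 N) → Site 3)) (Real.tanh (criticalBeta 3)) ∅ ^ 4 *
           crossMomentSq ((zdGraph 3).comap (Subtype.val : ↥(box 3 N) → Site 3)) (Real.tanh (criticalBeta 3)) (a 0) (a 1) (a 2) (a 3) (window N l)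
         ≤ C * bubbleSum ((zdGraph 3).comap (Subtype.val : ↥(box 3 N) → Site 3)) (Real.tanh (criticalBeta 3)) a (window N l) :=
  fun h => crossPairTree_of_pairHoleFilling h

end Summit.CriticalPhenomena.Ising3DConformalLimit.Theorems

end
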